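import Summits.HodgeConjecture.CorCM.MultiFieldWeilBlockGluing
import Summits.HodgeConjecture.CorCM.MultiFieldWeilAnyTwoSimpleDimLeThree
import HarnessLib

/-!
# MULTI-FIELD WEIL ENGINE — TWO FOREIGN PAIRS: any FOUR simple CM abelian varieties of dimension `≤ 3`, grouped in two pairs with linearly disjoint
# closure-composita — the Hodge conjecture for every `A₀^a × A₁^b × A₂^c × A₃^d`, given ONLY Markman's fourfold theorem

Cell `pub-hodgecm2` (COR-CM), seat b30 gen 31 (2026-08-24); count-neutral own lane MULTI-FIELD WEIL ENGINE (stem `MultiFieldWeil*`), second consumer of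
`CorCM/MultiFieldWeilBlockGluing.lean` (G8) over the roof `CorCM/MultiFieldWeilAnyTwoSimpleDimLeThree.lean` (G7).  Theorems only; no definition, no named fact, no
`sorry`.  HONEST FRAMING: conditional on the displayed Markman fourfold binder only; `HC_CM` is NOT proved and not asserted.

THE STATEMENT (**`hodgeConjectureFor_biproduct_comp_vec_of_two_foreign_pairs_of_markman`**).  `A₀, A₁, A₂, A₃` SIMPLE complex abelian varieties of CM type of
dimension `≤ 3` (`A_i ⊨ (K_i; Φ_i)`), such that the closure-composita of the two pairs are linearly disjoint:
`(L(K₀) ⊔ L(K₁)) ⊓ (L(K₂) ⊔ L(K₃)) = ℚ` (`L = normalClosure ℚ · ℂ`).  Then for every `κ : Fin N → Fin 4` the Hodge conjecture holds for `⨁_j ![A₀, A₁, A₂, A₃] (κ j)`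
— every `A₀^a × A₁^b × A₂^c × A₃^d`, up to dimension `12` in the factors and arbitrary powers — GIVEN ONLY `Markman2025_weilClasses_algebraic_abelianFourfold`: inside
each pair G7 (Moonen–Zarhin plus Markman where Weil classes occur), across the pairs G8 (the partial conjugation of `L(K₀) ⊔ L(K₁)` exists by linear disjointness).
Inside a pair NOTHING is assumed: `A₀ ∼ A₁`, shared imaginary quadratic subfields, equal fields are all allowed.

[cite: Markman2025SurveySecant, Thm. 1.2] [cite: MoonenZarhin1999LowDim, Thm. (0.1) (1), (4) with case (a), §5 (5.2)] [cite: Pohlmann1968, Thm 1]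
[cite: Gordon1999HodgeAVSurvey, §3 Theorem (proof), 7.5–7.7] [cite: Lang2002, VI §1 Thm. 1.14] [cite: MumfordAV1970, §19 Thm. 1]

## References
* [Markman2025SurveySecant] E. Markman, arXiv:2509.23403, Thm. 1.2.  [MoonenZarhin1999LowDim] B. Moonen, Yu. Zarhin, Math. Ann. 315 (1999).  [Pohlmann1968]
  H. Pohlmann, Ann. of Math. 88 (1968), Thm 1.  [Gordon1999HodgeAVSurvey] B. B. Gordon, *A survey of the Hodge conjecture for abelian varieties*.  [Lang2002] S. Lang,
  *Algebra*, VI §1.  [MumfordAV1970] D. Mumford, *Abelian Varieties*, §19.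
-/

noncomputable section

open CategoryTheory CategoryTheory.Limits NumberField IntermediateField

namespace Summit.HodgeConjecture.CorCM.MultiFieldWeil

open Literature.AlgebraicGeometry Literature.AlgebraicGeometry.Motives Literature.AlgebraicGeometry.HodgeTheory
open Literature.AlgebraicGeometry.ComplexMultiplication (IsCMTypeRealisation)
open Literature.AlgebraicTopology.SingularHomology
open Literature.NumberTheory.ComplexMultiplication

open scoped Classical

section TwoPairs

variable {K₀ K₁ K₂ K₃ : Type} [Field K₀] [NumberField K₀] [IsCMField K₀] [Field K₁] [NumberField K₁] [IsCMField K₁]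
  [Field K₂] [NumberField K₂] [IsCMField K₂] [Field K₃] [NumberField K₃] [IsCMField K₃]
  {N : ℕ} {A₀ A₁ A₂ A₃ : AbelianVariety ℂ} {Φ₀ : CMType K₀} {Φ₁ : CMType K₁} {Φ₂ : CMType K₂} {Φ₃ : CMType K₃}
  {ι₀ : 𝓞 K₀ →+* End A₀} {θ₀ : K₀ →+* Module.End ℂ (complexBetti A₀.X 1)}
  {ι₁ : 𝓞 K₁ →+* End A₁} {θ₁ : K₁ →+* Module.End ℂ (complexBetti A₁.X 1)}
  {ι₂ : 𝓞 K₂ →+* End A₂} {θ₂ : K₂ →+* Module.End ℂ (complexBetti A₂.X 1)}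
  {ι₃ : 𝓞 K₃ →+* End A₃} {θ₃ : K₃ →+* Module.End ℂ (complexBetti A₃.X 1)}

/-- **TWO FOREIGN PAIRS OF SIMPLE CM ABELIAN VARIETIES OF DIMENSION `≤ 3`, given ONLY Markman's fourfold theorem.**  `A₀, …, A₃` simple, of CM type, `dim ≤ 3`, with
`(L(K₀) ⊔ L(K₁)) ⊓ (L(K₂) ⊔ L(K₃)) = ℚ`.  Then the Hodge conjecture holds for `⨁_j ![A₀, A₁, A₂, A₃] (κ j)` for every `κ` — every `A₀^a × A₁^b × A₂^c × A₃^d`: the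
blocks `{A₀, A₁}` and `{A₂, A₃}` (G7 each) glued along the partial conjugation of `L(K₀) ⊔ L(K₁)` (G8).  `HC_CM` is NOT asserted.
[cite: Markman2025SurveySecant, Thm. 1.2] [cite: Gordon1999HodgeAVSurvey, §3 Theorem (proof)] [cite: Pohlmann1968, Thm 1] [cite: Lang2002, VI §1 Thm. 1.14] -/
theorem hodgeConjectureFor_biproduct_comp_vec_of_two_foreign_pairs_of_markman (hW4 : Markman2025_weilClasses_algebraic_abelianFourfold)
    (hA₀ : IsCMTypeRealisation Φ₀ A₀ ι₀ θ₀) (hA₁ : IsCMTypeRealisation Φ₁ A₁ ι₁ θ₁) (hA₂ : IsCMTypeRealisation Φ₂ A₂ ι₂ θ₂) (hA₃ : IsCMTypeRealisation Φ₃ A₃ ι₃ θ₃)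
    (hS₀ : A₀.IsSimple) (hS₁ : A₁.IsSimple) (hS₂ : A₂.IsSimple) (hS₃ : A₃.IsSimple) (h3₀ : A₀.dim ≤ 3) (h3₁ : A₁.dim ≤ 3) (h3₂ : A₂.dim ≤ 3) (h3₃ : A₃.dim ≤ 3)
    (hfor : (normalClosure ℚ K₀ ℂ ⊔ normalClosure ℚ K₁ ℂ) ⊓ (normalClosure ℚ K₂ ℂ ⊔ normalClosure ℚ K₃ ℂ) = ⊥) (κ : Fin N → Fin 4) :
    HodgeConjectureFor (⨁ fun j => (![A₀, A₁, A₂, A₃] : Fin 4 → AbelianVariety ℂ) (κ j)).dim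
      (⨁ fun j => (![A₀, A₁, A₂, A₃] : Fin 4 → AbelianVariety ℂ) (κ j)).X := by
  -- the family `(K₀, K₁, K₂, K₃)` over `Fin 4`
  let K : Fin 4 → Type := Fin.cons K₀ (Fin.cons K₁ (Fin.cons K₂ (Fin.cons K₃ finZeroElim)))
  letI instF : ∀ j, Field (K j) := Fin.cons ‹Field K₀› (Fin.cons ‹Field K₁› (Fin.cons ‹Field K₂› (Fin.cons ‹Field K₃› finZeroElim)))
  letI instN : ∀ j, NumberField (K j) :=
    Fin.cons ‹NumberField K₀› (Fin.cons ‹NumberField K₁› (Fin.cons ‹NumberField K₂› (Fin.cons ‹NumberField K₃› finZeroElim)))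
  haveI instC : ∀ j, IsCMField (K j) := Fin.cons ‹IsCMField K₀› (Fin.cons ‹IsCMField K₁› (Fin.cons ‹IsCMField K₂› (Fin.cons ‹IsCMField K₃› finZeroElim)))
  let Φ : ∀ j : Fin 4, CMType (K j) := Fin.cons Φ₀ (Fin.cons Φ₁ (Fin.cons Φ₂ (Fin.cons Φ₃ finZeroElim)))
  let ι : ∀ j : Fin 4, 𝓞 (K j) →+* End ((![A₀, A₁, A₂, A₃] : Fin 4 → AbelianVariety ℂ) j) := Fin.cons ι₀ (Fin.cons ι₁ (Fin.cons ι₂ (Fin.cons ι₃ finZeroElim)))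
  let θ : ∀ j : Fin 4, K j →+* Module.End ℂ (complexBetti ((![A₀, A₁, A₂, A₃] : Fin 4 → AbelianVariety ℂ) j).X 1) :=
    Fin.cons θ₀ (Fin.cons θ₁ (Fin.cons θ₂ (Fin.cons θ₃ finZeroElim)))
  have hA : ∀ j, IsCMTypeRealisation (Φ j) ((![A₀, A₁, A₂, A₃] : Fin 4 → AbelianVariety ℂ) j) (ι j) (θ j) :=
    Fin.cons hA₀ (Fin.cons hA₁ (Fin.cons hA₂ (Fin.cons hA₃ finZeroElim)))
  refine hodgeConjectureFor_prod_of_blocks_of_inf_eq_bot (K := K) (A := (![A₀, A₁, A₂, A₃] : Fin 4 → AbelianVariety ℂ)) (Φ := Φ) (ι := ι) (θ := θ)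
    hA (fun j => (j : ℕ) < 2) ?_ ?_ ?_ κ
  · -- the two composita are inside `L(K₀) ⊔ L(K₁)` and `L(K₂) ⊔ L(K₃)`
    refine le_bot_iff.1 (le_trans (inf_le_inf (iSup_le fun i => ?_) (iSup_le fun i => ?_)) hfor.le)
    · obtain ⟨i, hi⟩ := i
      fin_cases i
      · exact le_sup_left
      · exact le_sup_right
      · exact absurd hi (by decide)
      · exact absurd hi (by decide)
    · obtain ⟨i, hi⟩ := i
      fin_cases i
      · exact absurd (by decide) hi
      · exact absurd (by decide) hi
      · exact le_sup_left
      · exact le_sup_right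
  · -- block `{A₀, A₁}`: G7
    intro M ρ hρ
    let κ' : Fin M → Fin 2 := fun l => ⟨ρ l, hρ l⟩
    have hfun : (fun l => (![A₀, A₁, A₂, A₃] : Fin 4 → AbelianVariety ℂ) (ρ l)) = fun l => (![A₀, A₁] : Fin 2 → AbelianVariety ℂ) (κ' l) := by
      funext l
      have hc : ρ l = Fin.castAdd 2 (κ' l) := Fin.ext rfl
      rw [hc]
      generalize κ' l = c
      fin_cases c <;> rfl
    rw [hfun]
    exact hodgeConjectureFor_biproduct_comp_vec_of_any_two_simple_dim_le_three_of_markman hW4 hA₀ hA₁ hS₀ hS₁ h3₀ h3₁ κ'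
  · -- block `{A₂, A₃}`: G7
    intro M ρ hρ
    have hge : ∀ l, 2 ≤ (ρ l : ℕ) := fun l => not_lt.1 (hρ l)
    have hlt : ∀ l, (ρ l : ℕ) - 2 < 2 := fun l => by have h := (ρ l).isLt; omega
    let κ' : Fin M → Fin 2 := fun l => ⟨ρ l - 2, hlt l⟩
    have hfun : (fun l => (![A₀, A₁, A₂, A₃] : Fin 4 → AbelianVariety ℂ) (ρ l)) = fun l => (![A₂, A₃] : Fin 2 → AbelianVariety ℂ) (κ' l) := by
      funext l
      have hc : ρ l = Fin.natAdd 2 (κ' l) := Fin.ext (by rw [Fin.val_natAdd]; have := hge l; show (ρ l : ℕ) = 2 + ((ρ l : ℕ) - 2); omega)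
      rw [hc]
      generalize κ' l = c
      fin_cases c <;> rfl
    rw [hfun]
    exact hodgeConjectureFor_biproduct_comp_vec_of_any_two_simple_dim_le_three_of_markman hW4 hA₂ hA₃ hS₂ hS₃ h3₂ h3₃ κ'

/-- **Dominated form** (everything isogenous to some `A₀^a × A₁^b × A₂^c × A₃^d`, every abelian subvariety or quotient of one). [cite: Markman2025SurveySecant, Thm. 1.2]
[cite: MumfordAV1970, §19 Thm. 1] -/
theorem hodgeConjectureFor_of_avDominatedBy_comp_vec_of_two_foreign_pairs_of_markman (hW4 : Markman2025_weilClasses_algebraic_abelianFourfold)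
    (hA₀ : IsCMTypeRealisation Φ₀ A₀ ι₀ θ₀) (hA₁ : IsCMTypeRealisation Φ₁ A₁ ι₁ θ₁) (hA₂ : IsCMTypeRealisation Φ₂ A₂ ι₂ θ₂) (hA₃ : IsCMTypeRealisation Φ₃ A₃ ι₃ θ₃)
    (hS₀ : A₀.IsSimple) (hS₁ : A₁.IsSimple) (hS₂ : A₂.IsSimple) (hS₃ : A₃.IsSimple) (h3₀ : A₀.dim ≤ 3) (h3₁ : A₁.dim ≤ 3) (h3₂ : A₂.dim ≤ 3) (h3₃ : A₃.dim ≤ 3)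
    (hfor : (normalClosure ℚ K₀ ℂ ⊔ normalClosure ℚ K₁ ℂ) ⊓ (normalClosure ℚ K₂ ℂ ⊔ normalClosure ℚ K₃ ℂ) = ⊥) (κ : Fin N → Fin 4) {X : AbelianVariety ℂ}
    (hX : Domination.AVDominatedBy X (⨁ fun j => (![A₀, A₁, A₂, A₃] : Fin 4 → AbelianVariety ℂ) (κ j))) : HodgeConjectureFor X.dim X.X :=
  Domination.hodgeConjectureFor_of_avDominatedBy
    (hodgeConjectureFor_biproduct_comp_vec_of_two_foreign_pairs_of_markman hW4 hA₀ hA₁ hA₂ hA₃ hS₀ hS₁ hS₂ hS₃ h3₀ h3₁ h3₂ h3₃ hfor κ) hX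

end TwoPairs

end Summit.HodgeConjecture.CorCM.MultiFieldWeil
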